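import Literature.Topology.FourManifolds.CircleSurgeryExistence
import Literature.AlgebraicTopology.FundamentalGroup.SphereCoreComplementPi1
import Literature.AlgebraicTopology.FundamentalGroup.SphereSimplyConnected
import Literature.AlgebraicTopology.FundamentalGroupoid.SimplyConnectedComplPoint
import Mathlib.Analysis.Normed.Module.Connected
import HarnessLib

/-!
# Circle surgery on a simply connected 4-manifold gives a simply connected manifold

Topic `Literature/Topology/FourManifolds` (barrier seat
`provefact-Literature.Barriers.SmoothPoincare4.Stab-ad8c696e34`, seat 0).  A. Kosinski,
*Differential Manifolds* (1993), Ch. X §2, proof of Thm. (2.2), p. 201, in the lowest case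
`k = 1`, `l = 2` (surgery on a circle in a 4-manifold, cosphere `S²`): *"if `M` is simply
connected then so is `χ(M, S)`"* — `π₁(M ∖ S¹) = π₁(M)` because the normal fibre `ℝ³` of the
circle has simply connected puncture, `π₁(D̊² × S²) = 1`, and the two pieces meet in the path
connected punctured tube `S¹ × (B³ ∖ 0)` (Seifert–van Kampen, Hatcher 2002, Lemma 1.15).  The
tree proves this for the sphere-family surgeries of `SphereFamilySurgery.lean`
(`FramedSphereFamily.simplyConnectedSpace_of_surgery`, `SphereSurgeryPi1.lean`); this file is the
same argument for the circle surgeries of `CircleSurgery.lean` / `CircleSurgeryExistence.lean`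
(tubular neighbourhoods `ν : CircleNbhd (𝓡 4) c`, open gluings of `X ∖ c` and `D̊² × S²` along
`circleSurgeryRel ν`, the manifold `ν.Surgered`):

* `CircleNbhd.simplyConnectedSpace_complement_iff` — `X ∖ c` is simply connected iff `X` is
  (`VanKampen.simplyConnectedSpace_compl_core_iff` for the open embedding `ν : S¹ × ℝ³ → X`);
* `simplyConnectedSpace_discTimesSphere` — `D̊² × S²` is simply connected;
* `range_inter_range_eq_of_circleSurgeryRel`, `isPathConnected_range_inter_range_of_circleSurgeryRel`
  — the two pieces of an open gluing along `circleSurgeryRel ν` meet in `jB((D̊² ∖ 0) × S²)`,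
  which is path connected;
* `simplyConnectedSpace_of_circleSurgeryRel` — **every open gluing of `X ∖ c` and `D̊² × S²`
  along `circleSurgeryRel ν`, `X` simply connected, is simply connected**;
* `CircleNbhd.simplyConnectedSpace_surgered` — in particular `ν.Surgered` is simply connected
  (hence `ℤ`-orientable, `isOrientableOver_int_of_simplyConnectedSpace_holds`).

Everything is proved; no new notion, no named fact.

## References

* A. Kosinski, *Differential Manifolds* (1993), Ch. X §2, Thm. (2.2) (proof, p. 201).
  [Kosinski1993]
* A. Hatcher, *Algebraic Topology* (2002), Lemma 1.15, Prop. 1.14. [HatcherAT2002]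
-/

open scoped Manifold ContDiff Topology
open Set Function Metric Topology
open Literature.AlgebraicTopology.FundamentalGroup
open Literature.AlgebraicTopology.FundamentalGroup.VanKampen
open Literature.AlgebraicTopology.FundamentalGroupoid
  (isSimplyConnected_compl_singleton_of_isOpenEmbedding)

noncomputable section

universe u

namespace Literature.Topology.FourManifolds

/-! ### The pieces: `X ∖ c` and `D̊² × S²` -/

section Pieces

variable {X : Type u} [TopologicalSpace X] [T2Space X] [ChartedSpace ((EuclideanSpace ℝ (Fin 4))) X]
  {c : (Metric.sphere (0 : EuclideanSpace ℝ (Fin (1 + 1))) 1) → X} (ν : CircleNbhd (𝓡 4) c)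

omit [T2Space X] in
/-- The zero section of a tubular neighbourhood of a circle is the circle. [folklore] -/
theorem CircleNbhd.image_zeroSection :
    ν.toFun '' (univ ×ˢ ({0} : Set ((EuclideanSpace ℝ (Fin 3))))) = range c := by
  ext x
  constructor
  · rintro ⟨⟨u, w⟩, ⟨-, hw⟩, rfl⟩
    rw [mem_singleton_iff] at hw
    subst hw
    exact ⟨u, (ν.apply_zero u).symm⟩
  · rintro ⟨u, rfl⟩
    exact ⟨(u, 0), ⟨mem_univ _, rfl⟩, ν.apply_zero u⟩

/-- `ℝ³ ∖ 0` is simply connected (Hatcher 2002, Prop. 1.14). [cite: HatcherAT2002, Prop. 1.14] -/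
private theorem simplyConnectedSpace_compl_zero_three :
    SimplyConnectedSpace ↥(({0} : Set ((EuclideanSpace ℝ (Fin 3))))ᶜ) := by
  have h := isSimplyConnected_compl_singleton_of_isOpenEmbedding
    (M := (EuclideanSpace ℝ (Fin 3))) (i := id) IsOpenEmbedding.id
    (by rw [finrank_euclideanSpace, Fintype.card_fin]; omega)
  exact h

/-- `1 < dim ℝⁿ⁺²`. [folklore] -/
private theorem one_lt_rank_euclideanSpace_of_circleSurgery (n : ℕ) : 1 < Module.rank ℝ (EuclideanSpace ℝ (Fin (n + 1 + 1))) := by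
  rw [← Module.finrank_eq_rank, finrank_euclideanSpace, Fintype.card_fin]
  norm_cast
  omega

/-- The unit spheres `Sⁿ⁺¹` are path connected. [folklore] -/
private theorem pathConnectedSpace_unitSphere_of_circleSurgery (n : ℕ) : PathConnectedSpace (Metric.sphere (0 : EuclideanSpace ℝ (Fin (n + 1 + 1))) 1) :=
  isPathConnected_iff_pathConnectedSpace.1
    (isPathConnected_sphere (one_lt_rank_euclideanSpace_of_circleSurgery n) 0 zero_le_one)

/-- The circle `S¹ ⊆ ℝ²` is path connected. [folklore] -/
private theorem pathConnectedSpace_circle : PathConnectedSpace (Metric.sphere (0 : EuclideanSpace ℝ (Fin (1 + 1))) 1) := pathConnectedSpace_unitSphere_of_circleSurgery 0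

/-- The sphere `S² ⊆ ℝ³` is path connected. [folklore] -/
private theorem pathConnectedSpace_sphereTwo : PathConnectedSpace (Metric.sphere (0 : EuclideanSpace ℝ (Fin (2 + 1))) 1) := pathConnectedSpace_unitSphere_of_circleSurgery 1

/-- **`X ∖ c` is simply connected iff `X` is** (Kosinski 1993, X.2, proof of (2.2): the normal
fibre `ℝ³` of the circle has simply connected puncture;
`VanKampen.simplyConnectedSpace_compl_core_iff` for the open embedding `ν : S¹ × ℝ³ → X`).
[cite: Kosinski1993, Ch. X §2, Thm. 2.2 (proof)] -/
theorem CircleNbhd.simplyConnectedSpace_complement_iff [PathConnectedSpace X] :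
    SimplyConnectedSpace ↥ν.complement ↔ SimplyConnectedSpace X := by
  haveI := pathConnectedSpace_circle
  haveI := simplyConnectedSpace_compl_zero_three
  have h := simplyConnectedSpace_compl_core_iff
    (Z := (Metric.sphere (0 : EuclideanSpace ℝ (Fin (1 + 1))) 1)) (E := (EuclideanSpace ℝ (Fin 3))) (W := X)
    (φ := ν.toFun) ν.isOpenEmbedding
  have hset : (ν.toFun '' (univ ×ˢ ({0} : Set ((EuclideanSpace ℝ (Fin 3))))))ᶜ = (ν.complement : Set X) := by
    rw [ν.image_zeroSection]; rfl
  rw [← h]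
  exact (Homeomorph.setCongr hset.symm).toHomotopyEquiv.simplyConnectedSpace_iff

/-- **`D̊² × S²` is simply connected** (`D̊²` contractible, `π₁(S²) = 1`, Hatcher Prop. 1.12,
Prop. 1.14). [cite: HatcherAT2002, Prop. 1.12 and Prop. 1.14] -/
theorem simplyConnectedSpace_discTimesSphere : SimplyConnectedSpace ↥discTimesSphere := by
  -- `D̊² × S² ≅ B² × S²`
  let e1 : ↥discTimesSphere ≃ₜ ↥(ball (0 : (EuclideanSpace ℝ (Fin 2))) 1) × (Metric.sphere (0 : EuclideanSpace ℝ (Fin (2 + 1))) 1) :=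
    { toFun := fun b => (⟨b.1.1, mem_ball_zero_iff.2 ((mem_discTimesSphere_iff _).1 b.2)⟩, b.1.2)
      invFun := fun q => ⟨(q.1.1, q.2), (mem_discTimesSphere_iff _).2 (mem_ball_zero_iff.1 q.1.2)⟩
      left_inv := fun _ => rfl
      right_inv := fun _ => rfl
      continuous_toFun :=
        ((continuous_fst.comp continuous_subtype_val).subtype_mk _).prodMk
          (continuous_snd.comp continuous_subtype_val)
      continuous_invFun :=
        ((continuous_subtype_val.comp continuous_fst).prodMk continuous_snd).subtype_mk _ }
  haveI : ContractibleSpace (ball (0 : (EuclideanSpace ℝ (Fin 2))) 1) :=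
    (convex_ball (0 : (EuclideanSpace ℝ (Fin 2))) 1).contractibleSpace ⟨0, mem_ball_self one_pos⟩
  haveI : SimplyConnectedSpace ((Metric.sphere (0 : EuclideanSpace ℝ (Fin (2 + 1))) 1)) :=
    simplyConnectedSpace_euclideanSphere (n := 2) (hn := le_rfl)
  obtain ⟨hv⟩ := ContractibleSpace.hequiv_unit (ball (0 : (EuclideanSpace ℝ (Fin 2))) 1)
  have e2 : ContinuousMap.HomotopyEquiv
      (↥(ball (0 : (EuclideanSpace ℝ (Fin 2))) 1) × ((Metric.sphere (0 : EuclideanSpace ℝ (Fin (2 + 1))) 1)))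
      (Unit × ((Metric.sphere (0 : EuclideanSpace ℝ (Fin (2 + 1))) 1))) :=
    hv.prodCongr (ContinuousMap.HomotopyEquiv.refl _)
  have e3 : (Unit × ((Metric.sphere (0 : EuclideanSpace ℝ (Fin (2 + 1))) 1))) ≃ₜ
      ((Metric.sphere (0 : EuclideanSpace ℝ (Fin (2 + 1))) 1)) := Homeomorph.punitProd _
  have e := (e1.toHomotopyEquiv.trans e2).trans e3.toHomotopyEquiv
  exact e.simplyConnectedSpace_iff.2 inferInstance

/-- **The punctured piece `(D̊² ∖ 0) × S²` is path connected**: it is the image of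
`(0, 1) × S¹ × S²` under `(t, u, s) ↦ (t u, s)`. [folklore] -/
theorem isPathConnected_puncturedDiscTimesSphere :
    IsPathConnected {b : ↥discTimesSphere | b.1.1 ≠ 0} := by
  haveI := pathConnectedSpace_circle
  haveI := pathConnectedSpace_sphereTwo
  -- the image `B` of `(0,1) × S¹ × S²` in `ℝ² × S²`
  let g : ℝ × ((Metric.sphere (0 : EuclideanSpace ℝ (Fin (1 + 1))) 1) × (Metric.sphere (0 : EuclideanSpace ℝ (Fin (2 + 1))) 1)) →
      ((EuclideanSpace ℝ (Fin 2))) × (Metric.sphere (0 : EuclideanSpace ℝ (Fin (2 + 1))) 1) :=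
    fun q => (q.1 • (q.2.1 : (EuclideanSpace ℝ (Fin 2))), q.2.2)
  have hg : Continuous g :=
    (continuous_fst.smul (continuous_subtype_val.comp (continuous_fst.comp continuous_snd))).prodMk
      (continuous_snd.comp continuous_snd)
  have hA : IsPathConnected ((Ioo (0 : ℝ) 1) ×ˢ (univ : Set ((Metric.sphere (0 : EuclideanSpace ℝ (Fin (1 + 1))) 1) ×
      (Metric.sphere (0 : EuclideanSpace ℝ (Fin (2 + 1))) 1)))) :=
    ((convex_Ioo (0 : ℝ) 1).isPathConnected ⟨2⁻¹, by norm_num⟩).prod isPathConnected_univ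
  set B : Set (((EuclideanSpace ℝ (Fin 2))) × (Metric.sphere (0 : EuclideanSpace ℝ (Fin (2 + 1))) 1)) :=
    g '' ((Ioo (0 : ℝ) 1) ×ˢ univ) with hBdef
  have hB : IsPathConnected B := hA.image hg
  -- `B ⊆ D̊² × S²`, and its preimage in the subtype is the punctured piece
  have hBsub : B ⊆ (discTimesSphere : Set _) := by
    rintro _ ⟨⟨t, u, s⟩, ⟨ht, -⟩, rfl⟩
    show ((t • (u : (EuclideanSpace ℝ (Fin 2))), s) : _ × _) ∈ discTimesSphere
    rw [mem_discTimesSphere_iff, norm_smul, norm_eq_of_mem_sphere u, mul_one, Real.norm_of_nonneg ht.1.le]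
    exact ht.2
  have hpre := hB.preimage_coe hBsub
  have hset : {b : ↥discTimesSphere | b.1.1 ≠ 0} = {b : ↥discTimesSphere | b.1 ∈ B} := by
    ext b
    simp only [mem_setOf_eq]
    constructor
    · intro hz
      have hz1 : ‖b.1.1‖ < 1 := (mem_discTimesSphere_iff _).1 b.2
      have hpos : 0 < ‖b.1.1‖ := norm_pos_iff.2 hz
      have hu : ‖b.1.1‖⁻¹ • b.1.1 ∈ (Metric.sphere (0 : EuclideanSpace ℝ (Fin (1 + 1))) 1) := by
        rw [mem_sphere_zero_iff_norm, norm_smul, norm_inv, norm_norm, inv_mul_cancel₀ hpos.ne']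
      refine ⟨(‖b.1.1‖, ⟨‖b.1.1‖⁻¹ • b.1.1, hu⟩, b.1.2), ⟨⟨hpos, hz1⟩, mem_univ _⟩, ?_⟩
      show ((‖b.1.1‖ • (‖b.1.1‖⁻¹ • b.1.1), b.1.2) : ((EuclideanSpace ℝ (Fin 2))) × (Metric.sphere (0 : EuclideanSpace ℝ (Fin (2 + 1))) 1)) = b.1
      rw [smul_smul, mul_inv_cancel₀ hpos.ne', one_smul]
    · rintro ⟨⟨t, u, s'⟩, ⟨ht, -⟩, hq⟩
      have h1 : b.1.1 = t • (u : (EuclideanSpace ℝ (Fin 2))) := (congrArg Prod.fst hq).symm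
      rw [h1]
      exact smul_ne_zero ht.1.ne' (ne_zero_of_mem_unit_sphere u)
  rw [hset]
  exact hpre

end Pieces

/-! ### The glued space -/

section Gluing

variable {X : Type u} [TopologicalSpace X] [T2Space X] [ChartedSpace ((EuclideanSpace ℝ (Fin 4))) X]
  {c : (Metric.sphere (0 : EuclideanSpace ℝ (Fin (1 + 1))) 1) → X} {ν : CircleNbhd (𝓡 4) c}
  {P : Type u} [TopologicalSpace P] {jA : ↥ν.complement → P} {jB : ↥discTimesSphere → P}
  (hA : Topology.IsOpenEmbedding jA) (hB : Topology.IsOpenEmbedding jB) (hcov : range jA ∪ range jB = univ)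
  (hrel : ∀ a b, jA a = jB b ↔ circleSurgeryRel ν a b)

omit [TopologicalSpace P] in
include hrel in
/-- **The two pieces meet in the punctured handle** `jB((D̊² ∖ 0) × S²)`: a point `jB (z, v)` is
in the image of `jA` iff `z ≠ 0` (it is then `jA (ν (z/|z|, |z| v))`). [folklore] -/
theorem range_inter_range_eq_of_circleSurgeryRel :
    range jA ∩ range jB = jB '' {b : ↥discTimesSphere | b.1.1 ≠ 0} := by
  ext y
  constructor
  · rintro ⟨⟨a, rfl⟩, ⟨b, hb⟩⟩
    obtain ⟨u, t, ht, hb1, -⟩ := (hrel a b).1 hb.symm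
    refine ⟨b, ?_, hb⟩
    show b.1.1 ≠ 0
    rw [hb1]
    exact smul_ne_zero ht.1.ne' (ne_zero_of_mem_unit_sphere u)
  · rintro ⟨b, hz, rfl⟩
    change b.1.1 ≠ 0 at hz
    refine ⟨?_, mem_range_self _⟩
    have hz1 : ‖b.1.1‖ < 1 := (mem_discTimesSphere_iff _).1 b.2
    have hpos : 0 < ‖b.1.1‖ := norm_pos_iff.2 hz
    have hu : ‖b.1.1‖⁻¹ • b.1.1 ∈ (Metric.sphere (0 : EuclideanSpace ℝ (Fin (1 + 1))) 1) := by
      rw [mem_sphere_zero_iff_norm, norm_smul, norm_inv, norm_norm, inv_mul_cancel₀ hpos.ne']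
    have hw : ‖b.1.1‖ • (b.1.2 : (EuclideanSpace ℝ (Fin 3))) ≠ 0 :=
      smul_ne_zero hpos.ne' (ne_zero_of_mem_unit_sphere _)
    have ha : ν.toFun (⟨‖b.1.1‖⁻¹ • b.1.1, hu⟩, ‖b.1.1‖ • (b.1.2 : (EuclideanSpace ℝ (Fin 3)))) ∈ ν.complement := by
      rw [CircleNbhd.mem_complement_iff]
      exact fun h => hw ((ν.apply_mem_range_iff).1 h)
    refine ⟨⟨_, ha⟩, (hrel _ _).2 ⟨⟨‖b.1.1‖⁻¹ • b.1.1, hu⟩, ‖b.1.1‖, ⟨hpos, hz1⟩, ?_, rfl⟩⟩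
    show b.1.1 = ‖b.1.1‖ • (‖b.1.1‖⁻¹ • b.1.1)
    rw [smul_smul, mul_inv_cancel₀ hpos.ne', one_smul]

include hB hrel in
/-- The intersection of the two pieces is path connected. [folklore] -/
theorem isPathConnected_range_inter_range_of_circleSurgeryRel :
    IsPathConnected (range jA ∩ range jB) := by
  rw [range_inter_range_eq_of_circleSurgeryRel hrel]
  exact isPathConnected_puncturedDiscTimesSphere.image hB.continuous

/-- A base point in the punctured tube: `ν (u₀, ½ e₀)`. [folklore] -/
theorem CircleNbhd.exists_basePoint (ν : CircleNbhd (𝓡 4) c) :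
    ∃ (a : ↥ν.complement) (b : ↥discTimesSphere), circleSurgeryRel ν a b := by
  let u₀ : (Metric.sphere (0 : EuclideanSpace ℝ (Fin (1 + 1))) 1) := Classical.arbitrary _
  let v₀ : (Metric.sphere (0 : EuclideanSpace ℝ (Fin (2 + 1))) 1) := spherePt 2
  have hw : (2⁻¹ : ℝ) • (v₀ : (EuclideanSpace ℝ (Fin 3))) ≠ 0 :=
    smul_ne_zero (by norm_num) (ne_zero_of_mem_unit_sphere _)
  let a : ↥ν.complement := ⟨ν.toFun (u₀, (2⁻¹ : ℝ) • (v₀ : (EuclideanSpace ℝ (Fin 3)))), by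
    rw [CircleNbhd.mem_complement_iff]
    exact fun h => hw ((ν.apply_mem_range_iff).1 h)⟩
  let b : ↥discTimesSphere := ⟨((2⁻¹ : ℝ) • (u₀ : (EuclideanSpace ℝ (Fin 2))), v₀), by
    rw [mem_discTimesSphere_iff, norm_smul, norm_eq_of_mem_sphere u₀]; norm_num⟩
  exact ⟨a, b, u₀, 2⁻¹, ⟨by norm_num, by norm_num⟩, rfl, rfl⟩

include hA hB hcov hrel in
/-- **`π₁(jA(X ∖ c)) → π₁(P)` is onto** for an open gluing along `circleSurgeryRel ν` with
`X ∖ c` path connected (van Kampen generation, Hatcher Lemma 1.15, with `π₁(D̊² × S²) = 1`).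
[cite: Kosinski1993, Ch. X §2, Thm. 2.2 (proof)] -/
theorem surjective_inclHom_range_jA_of_circleSurgeryRel [PathConnectedSpace ↥ν.complement]
    {a₀ : ↥ν.complement} {b₀ : ↥discTimesSphere} (h₀ : circleSurgeryRel ν a₀ b₀) :
    Function.Surjective (inclHom (range jA) (jA a₀) (mem_range_self a₀)) := by
  have hxT : jA a₀ ∈ range jB := ⟨b₀, ((hrel a₀ b₀).2 h₀).symm⟩
  haveI := simplyConnectedSpace_discTimesSphere
  have hUpc : IsPathConnected (range jA) := isPathConnected_range hA.continuous
  have hTpc : IsPathConnected (range jB) := isPathConnected_range hB.continuous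
  have hmeet := isPathConnected_range_inter_range_of_circleSurgeryRel hB hrel
  have hgen := closure_range_inclHom_union_eq_top hA.isOpen_range hB.isOpen_range hcov
    (mem_range_self a₀) hxT hUpc hTpc hmeet
  haveI : SimplyConnectedSpace ↥(range jB) :=
    hB.isEmbedding.toHomeomorph.toHomotopyEquiv.simplyConnectedSpace_iff.1 inferInstance
  rw [← MonoidHom.range_eq_top, ← top_le_iff, ← hgen, Subgroup.closure_le, MonoidHom.coe_range]
  rintro g (hg | ⟨x, rfl⟩)
  · exact hg
  · rw [Subsingleton.elim x 1, map_one]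
    exact ⟨1, map_one _⟩

include hA hB hcov hrel in
/-- **Circle surgery preserves simple connectivity** (Kosinski 1993, X.2, proof of Thm. (2.2),
p. 201, `k = 1`, `l = 2`): every open gluing `P = jA(X ∖ c) ∪ jB(D̊² × S²)` along
`circleSurgeryRel ν` of a simply connected `X` is simply connected (`π₁(X ∖ c) = π₁(X) = 1`,
`π₁(D̊² × S²) = 1`, connected intersection, van Kampen). [cite: Kosinski1993, Ch. X §2, Thm. 2.2 (proof)] -/
theorem simplyConnectedSpace_of_circleSurgeryRel [SimplyConnectedSpace X] : SimplyConnectedSpace P := by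
  haveI : SimplyConnectedSpace ↥ν.complement := ν.simplyConnectedSpace_complement_iff.2 inferInstance
  haveI := simplyConnectedSpace_discTimesSphere
  obtain ⟨a₀, b₀, h₀⟩ := ν.exists_basePoint
  have hxT : jA a₀ ∈ range jB := ⟨b₀, ((hrel a₀ b₀).2 h₀).symm⟩
  have hsurj := surjective_inclHom_range_jA_of_circleSurgeryRel hA hB hcov hrel h₀
  haveI : SimplyConnectedSpace ↥(range jA) :=
    hA.isEmbedding.toHomeomorph.toHomotopyEquiv.simplyConnectedSpace_iff.1 inferInstance
  haveI : Subsingleton (_root_.FundamentalGroup P (jA a₀)) :=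
    ⟨fun g h => by
      obtain ⟨g', rfl⟩ := hsurj g
      obtain ⟨h', rfl⟩ := hsurj h
      rw [Subsingleton.elim g' h']⟩
  haveI : PathConnectedSpace P := by
    rw [pathConnectedSpace_iff_univ, ← hcov]
    exact (isPathConnected_range hA.continuous).union (isPathConnected_range hB.continuous)
      ⟨jA a₀, mem_range_self _, hxT⟩
  exact simplyConnectedSpace_of_subsingleton (jA a₀)

end Gluing

/-! ### The surgered manifold -/

section Surgered

variable {X : Type u} [TopologicalSpace X] [T2Space X] [ChartedSpace ((EuclideanSpace ℝ (Fin 4))) X]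
  [IsManifold (𝓡 4) ∞ X] {c : (Metric.sphere (0 : EuclideanSpace ℝ (Fin (1 + 1))) 1) → X}

/-- **The surgered manifold `ν.Surgered` of a circle in a simply connected 4-manifold is simply
connected** (Kosinski 1993, X.2, proof of (2.2), `k = 1`, `l = 2`). [cite: Kosinski1993, Ch. X §2, Thm. 2.2 (proof)] -/
theorem CircleNbhd.simplyConnectedSpace_surgered [SimplyConnectedSpace X] (ν : CircleNbhd (𝓡 4) c) :
    SimplyConnectedSpace ν.Surgered := by
  obtain ⟨jA, jB, hP⟩ := isOpenGluing_iff.1 ν.isOpenGluing_surgered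
  exact simplyConnectedSpace_of_circleSurgeryRel ⟨hP.1.isEmbedding, hP.2.1⟩
    ⟨hP.2.2.1.isEmbedding, hP.2.2.2.1⟩ hP.2.2.2.2.1 hP.2.2.2.2.2

end Surgered

end Literature.Topology.FourManifolds

end
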